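import Summits.BirchSwinnertonDyer.BirchSwinnertonDyer.Theorems.ByReductionTypeAtTwoOrdKatoHalfAtTwoIsoPosDiscEpsilon
import Summits.BirchSwinnertonDyer.BirchSwinnertonDyer.Theorems.AlignedTransportAtTwoMainConjectureOfRankZeroBSDAtTwoFineRoadLimRelUpstairs
import HarnessLib

/-!
# Route ByReductionTypeAtTwo, crux `OrdKatoHalfAtTwoIso` (stmt-BirchSwinnertonDyer-19573), cell [`ρ̄₂` onto ∧ `0 < Δ`]
# (child PAIR 24097, conjunct `OrdKatoHalfAtTwoIsoPosDisc`) and child B7′ (23921): the RELAXED-AT-∞ `μ`-DOOR in the kernel —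
# GENUINE classes booked at `c_∞·L₂`, the archimedean `Λ/2`, and the relaxed fine dual; no half class (theorems only)

Seat `cruxlead-stmt-BirchSwinnertonDyer-19573-w2` GEN 5 (prover WIDTH under the LEAD lineage `cruxlead-19573`; HOME
`run/shared/lean/pub/bsd-2adic/`; pen RC-406 (2) ★ lane «RELAXED-GENUINE», `--supports` 23921 / 19573). HONEST FRAMING (cell
bsd-2adic): BSD is not proved by any of this; neither the crux nor its `0 < Δ` conjunct nor B7′ is proved here. THEOREMS ONLY (no
definition, no named fact, no `sorry`): every arithmetic input is an explicit DISPLAYED hypothesis of the door; nothing is asserted.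

THE ROAD (MEMO-7 (1.1)(h) = the reserve paper [ASP] Thm. 6.9 (i)(ii), `Δ_E > 0`; triage r1-2 GEN 36 §G «absorbs at the
bookkeeping step»). On a two-real-component curve every GENUINE Kato class `z` is booked by the Coleman map at `c_∞·L₂ = 2·L₂^{tree}`
(lead F-27a), so the STRICT-at-`∞` sequence `𝐇¹ → P → X → X₀ → 0` only yields `μ(X) ≤ 1 + μ(L₂^{tree}) + μ(X₀)` — the lost
factor `2` that the HALF-class reading P⁺ / Col½ (`HasColemanHalfClassPackageAtTwo`, memo tier) buys back with `y = z/2`. The relaxed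
road buys it back WITHOUT naming a half class: replace `X` by the dual `X^{rel}` of the Selmer group RELAXED at the real places, `X₀` by
`X₀^{rel}` (tree: `FineSelmerDualDataRelaxedInf`, -ty p600292). Then (Poitou–Tate for (`H¹_f` at `2`; `0` at real) ⊂ (same;
full at real), `𝐇¹_f = 0`): `(Sel^{rel}/Sel)^∨ ≅ H¹(ℝ, T₂E)⟦Γ⟧ = Λ/2`, i.e. **`ℓ₍₂₎(X^{rel}) = ℓ₍₂₎(X) + ord₂ c_∞`** ([ASP] 6.9 (i));
and the relaxed four-term sequence `𝐇¹_∞ → P → X^{rel} → X₀^{rel} → 0` (𝐇¹_∞ = classes trivial at the real places, which CONTAINS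
Kato's corestricted zeta module — `𝒦_m = ℚ(ζ_{2^m})` is totally imaginary) gives
`ℓ₍₂₎(X^{rel}) ≤ ord₂ c_∞ + μ(L₂^{tree}) + ℓ₍₂₎(X₀^{rel})` ([ASP] 6.9 (ii), no Euler-system bound). The `ord₂ c_∞` CANCELS:
`μ(X) ≤ μ(L₂^{tree}) + ℓ₍₂₎(X₀^{rel})`. The price moves from the
element (a half class) to the Selmer structure: RELAXED statement (A₂) «`ℓ₍₂₎(X₀^{rel ∞}) = 0`», which on this cell follows from
Iwasawa's `μ₂ = 0` for `ℚ(E[2], √−1)` (Iw⁺) by Lim 2017 Thm. 3.5 at `2` UPSTAIRS (tree named fact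
`Lim2017.thm35_at_two_upstairs_fineSelmer_twoTorsion_finite_of_classicalMuVanishes`) and the kernel descent of cell bsd-f1-sign2
(`…FineRoadLimRelUpstairs.lengthAt_relaxed_eq_zero_of_upstairs_two` — triage THEOREM H (H2) in the kernel).

* §1 length helpers at `(2)`: `lengthAt_augIdealP_quotient_span_C_pow_mul` (`ℓ₍ₚ₎(Λ/(p^e·G)) = e + μ(G)`),
  `lengthAt_add_le_of_surjective_of_le_lengthAt_ker` (an extension `K ↪ X^{rel} ↠ X` with `e ≤ ℓ(K)` gives `ℓ(X) + e ≤ ℓ(X^{rel})`),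
  `one_le_lengthAt_of_injective_of_quotient_augIdealP` (`Λ/(p) ↪ K ⇒ 1 ≤ ℓ₍ₚ₎(K)`: the archimedean `Λ/2`).
* §2 **`mu_le_mu_of_relaxedColemanSemilinear_of_arch`** — THE RELAXED `μ`-DOOR, per datum (abstract relaxed module `Xr`, typed
  `Yr : FineSelmerDualDataRelaxedInf`): ideal `P ⊆ Λ`, `M ⊆ P`, `τ : P →ₛₗ[θ] Xr` killing `M`, `π : Xr ↠ Yr.X` exact after `τ`,
  image clause `s·(2^e·G) ∈ M` (`s ∉ (2)`), archimedean clause `ℓ₍₂₎(X) + e ≤ ℓ₍₂₎(Xr)`, relaxed (A₂) `ℓ₍₂₎(Yr.X) = 0` ⇒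
  `μ(X) ≤ μ(G)`; `mu_eq_zero_…` (`G ∉ (2)`); `…_of_finite_fineRelaxed_pTorsion` (relaxed (A₂) as «`Sel₀^{rel∞}[2]` finite»);
  `…_of_archExtension_…` (archimedean clause as DATA: `Xr ↠ X` with `Λ/2 ↪ ker`). At `e = 0`, `Xr = X` this is GEN 4's strict door;
  at `e = 1` it is the `0 < Δ` bookkeeping with GENUINE classes.
* §3 `katoMuPartAtTwo_of_relaxedColeman_irr` — `X5.O1.KatoMuPartAtTwo W` at ONE `E[2]`-irreducible curve from the relaxed data for
  all cyclotomic data (analytic `μ₂ = 0`, p642753, gives `G₁ ∉ (2)`).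
* sequel `…RelaxedMuDoorPosDisc`: the cell's conjunct `OrdKatoHalfAtTwoIsoPosDisc` BY NAME ⟸ (relaxed data on the cell) + (relaxed
  (A₂) on the cell ⟸ Iw⁺ + Lim@2 upstairs) + Abbes–Ullmo + Kato 17.4 (1)(2).

What this is NOT: the relaxed data are passed here as an `∃`-over-Types hypothesis (`Xr` abstract) — a DOOR, not a displayed
binder; the honest binder pins `Xr := X^{rel ∞}(W/ℚ_∞)` = `SelmerDualDataRelaxedInf` (Literature typing p703162, in review) and is
the sequel `…RelaxedGenuineDefs`. The memo-tier content that remains: the relaxed Poitou–Tate/Coleman package at `2` (Kato 17.11,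
16.6, (17.13.1) with the relaxed-at-`∞` structures; Kato-witnessed by Kato's OWN classes, no half class) and [ASP] 6.9 (i).

References: [Kato2004Asterisque] Thm 12.4–12.6, 16.6, Prop 17.11, §17.13; reserve [ASP] §6.6 Thm 6.9 (i)(ii) (UPHELD 2026-08-08);
[GreenbergLNM1716] §1 p. 60, §4 Lemma 4.6 (pp. 106–107), Prop 5.8; [CoatesSujatha2005] (A); [Lim2017FineSelmer] Thm 3.5, Lemma 3.2;
MEMO-7 (1.1)(h), Thm D; triage r1-2 GEN 36 §C Thm H, §G; tree p699886/p700838 (w2 GEN 4), p600292/p605725 (bsd-f1-sign2).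
-/

set_option autoImplicit false
set_option linter.dupNamespace false

noncomputable section

open scoped Classical MatrixGroups ModularForm NumberField
open CongruenceSubgroup WeierstrassCurve Field IsDedekindDomain NumberField
open Literature.NumberTheory.GaloisRepresentations
open Literature.NumberTheory.GaloisCohomology
open Literature.NumberTheory.EllipticCurves Literature.NumberTheory.EllipticCurves.ModularForms
open Literature.NumberTheory.EllipticCurves.Kato2004
  Literature.NumberTheory.EllipticCurves.Kato2004.EulerSystemValues
open Literature.NumberTheory.EllipticCurves.Rank1Residual
open Literature.NumberTheory.EllipticCurves.Greenberg1999
open Literature.NumberTheory.IwasawaTheory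
open Summit.BirchSwinnertonDyer.BirchSwinnertonDyer.Theorems.Rank1ResidualX1Defs
  Summit.BirchSwinnertonDyer.BirchSwinnertonDyer.Rank1Residual
  Summit.BirchSwinnertonDyer.BirchSwinnertonDyer.Rank1Residual.CoreAssembly
open Summit.BirchSwinnertonDyer.Rank1Residual Summit.BirchSwinnertonDyer.Rank1Residual.X5
  Summit.BirchSwinnertonDyer.Rank1Residual.X1.MuLambda
open Summit.BirchSwinnertonDyer.BirchSwinnertonDyer.Theorems.OrdKatoOptimalAtTwo
  Summit.BirchSwinnertonDyer.BirchSwinnertonDyer.Theorems.OrdKatoIntAtTwo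
open Summit.BirchSwinnertonDyer.BirchSwinnertonDyer.Theses.ByReductionTypeAtTwo
open Summit.BirchSwinnertonDyer.BirchSwinnertonDyer.Theorems.AlignedTransportAtTwoFineRoad

namespace Summit.BirchSwinnertonDyer.BirchSwinnertonDyer.Theorems.SteinbergFibreAtTwo

/-! ## §1 Length helpers at the prime `(p)` of `Λ` -/

section Length

variable {p : ℕ} [Fact p.Prime]

/-- **`ℓ₍ₚ₎(Λ/(p^e·G)) = e + μ(G)`** for `G ≠ 0`: additivity along `Λ/(p^e·G) ⊇ (p^e)/(p^e G) ≅ Λ/(G)`,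
`ℓ₍ₚ₎(Λ/(p^e)) = e` and `ℓ₍ₚ₎(Λ/(G)) = μ(G)`. The local length that the booking «genuine class ↦ `c_∞·L₂`, `c_∞ = 2^e`» costs.
[cite: Washington1997, §13.2] [cite: BourbakiAC5to7, Ch. VII §4.5] -/
theorem lengthAt_augIdealP_quotient_span_C_pow_mul {G : IwasawaAlgebra p} (hG : G ≠ 0) (e : ℕ)
    (𝔭 : PrimeSpectrum (IwasawaAlgebra p)) (h𝔭 : 𝔭.asIdeal = IwasawaAlgebra.augIdealP p) :
    Module.lengthAt (IwasawaAlgebra p)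
        (IwasawaAlgebra p ⧸ Ideal.span {PowerSeries.C (((p : ℕ) : ℤ_[p]) ^ e) * G}) 𝔭 = e + mu G := by
  have hht : 𝔭.asIdeal.height = 1 := by rw [h𝔭]; exact IwasawaAlgebra.height_augIdealP_holds p
  have hC0 : (PowerSeries.C (((p : ℕ) : ℤ_[p]) ^ e) : IwasawaAlgebra p) ≠ 0 := by
    rw [map_pow]; exact pow_ne_zero _ (IwasawaAlgebra.prime_C p).ne_zero
  have hpmem : (PowerSeries.C ((p : ℕ) : ℤ_[p]) : IwasawaAlgebra p) ∈ 𝔭.asIdeal := by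
    rw [h𝔭, IwasawaAlgebra.augIdealP]; exact Ideal.mem_span_singleton_self _
  rw [Module.lengthAt_quotient_span_singleton_mul G hC0 𝔭, lengthAt_quotient_C_pow e 𝔭 hht, if_pos hpmem,
    lengthAt_augIdealP_quotient_span_singleton_eq_mu hG 𝔭 h𝔭]
  simp

variable {R : Type*} [CommRing R] {X Xr : Type*} [AddCommGroup X] [Module R X] [AddCommGroup Xr] [Module R Xr]

/-- **The archimedean clause from an extension**: if `q : X^{rel} ↠ X` is surjective and `e ≤ ℓ_𝔭(ker q)` then
`ℓ_𝔭(X) + e ≤ ℓ_𝔭(X^{rel})` (additivity of local length along `0 → ker q → X^{rel} → X → 0`). For `p = 2`, `0 < Δ`: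
`ker q = (Sel^{rel}/Sel)^∨ ≅ Λ/2`, `e = 1 = ord₂ c_∞`. [cite: GreenbergLNM1716, §4 Lemma 4.6 (PDF pp. 106–107) (shape)] -/
theorem lengthAt_add_le_of_surjective_of_le_lengthAt_ker (q : Xr →ₗ[R] X) (hq : Function.Surjective q)
    (𝔭 : PrimeSpectrum R) {e : ℕ∞} (he : e ≤ Module.lengthAt R (LinearMap.ker q) 𝔭) :
    Module.lengthAt R X 𝔭 + e ≤ Module.lengthAt R Xr 𝔭 := by
  rw [Module.lengthAt_eq_add_quotient (LinearMap.ker q) 𝔭,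
    Module.lengthAt_eq_of_linearEquiv (q.quotKerEquivOfSurjective hq) 𝔭]
  calc Module.lengthAt R X 𝔭 + e = e + Module.lengthAt R X 𝔭 := add_comm _ _
    _ ≤ Module.lengthAt R (LinearMap.ker q) 𝔭 + Module.lengthAt R X 𝔭 := add_le_add he le_rfl

/-- **`Λ/(p) ↪ K ⇒ 1 ≤ ℓ₍ₚ₎(K)`**: the archimedean `Λ/2` inside `ker(X^{rel} ↠ X)` has local length `1` at `(2)`
(`ℓ₍ₚ₎(Λ/(p)) = 1`). [cite: Washington1997, §13.2] -/
theorem one_le_lengthAt_of_injective_of_quotient_augIdealP {K : Type*} [AddCommGroup K] [Module (IwasawaAlgebra p) K]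
    (j : (IwasawaAlgebra p ⧸ IwasawaAlgebra.augIdealP p) →ₗ[IwasawaAlgebra p] K) (hj : Function.Injective j)
    (𝔭 : PrimeSpectrum (IwasawaAlgebra p)) (h𝔭 : 𝔭.asIdeal = IwasawaAlgebra.augIdealP p) :
    1 ≤ Module.lengthAt (IwasawaAlgebra p) K 𝔭 := by
  have h1 : Module.lengthAt (IwasawaAlgebra p) (IwasawaAlgebra p ⧸ IwasawaAlgebra.augIdealP p) 𝔭 = 1 := by
    rw [← h𝔭]; exact Module.lengthAt_quotient_self 𝔭
  rw [← h1]
  exact Module.lengthAt_le_of_injective j hj 𝔭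

end Length

/-! ## §2 Per datum: the RELAXED `μ`-door (abstract relaxed module, typed relaxed fine datum) -/

section PerDatum

variable {W : WeierstrassCurve ℚ} [W.IsElliptic] [W.IsGloballyMinimal]
  {κ : ZpExtension ℚ 2} {γ : absoluteGaloisGroup ℚ} {D : W.SelmerDualData κ γ}
  {Xr : Type*} [AddCommGroup Xr] [Module (IwasawaAlgebra 2) Xr] {Yr : W.FineSelmerDualDataRelaxedInf κ γ}

omit [W.IsElliptic] [W.IsGloballyMinimal] in
/-- **THE RELAXED `μ`-DOOR WITH SLACK (KERNEL; span-free, image-free, NO half class).** Data: a Selmer dual datum `D`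
(`X = X(E/ℚ_∞)`, STRICT at `∞`), an abstract `Λ`-module `Xr` (READING: the dual `X^{rel}` of the Selmer group RELAXED at the real
places) and a relaxed fine datum `Yr` (`X₀^{rel}`); a ring automorphism `θ` of `Λ`, an ideal `P ⊆ Λ`, `M ⊆ P`, a `θ`-SEMILINEAR
column map `τ : P → Xr` killing `M` (READING: Poitou–Tate for (`H¹_f` at `2`, `0` at real) ⊂ (full at `2`, `0` at real) on the
`T`-side; `M` = Coleman coordinates of GENUINE Kato classes, trivial at the real places), `π : Xr → X₀^{rel}` exact after `τ`
(surjectivity of `π` is not needed); the IMAGE CLAUSE `s·(2^e·G) ∈ M` with `s ∉ (2)` (the genuine classes are booked at `c_∞·L₂`,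
`c_∞ = 2^e`: F-27a); the ARCHIMEDEAN CLAUSE `ℓ₍₂₎(X) + e ≤ ℓ₍₂₎(Xr)` ([ASP] Thm 6.9 (i): `(Sel^{rel}/Sel)^∨ ≅ Λ/2`, worth `e = 1`);
and RELAXED (A₂) `ℓ₍₂₎(X₀^{rel}) = 0`. Conclusion: `μ(X) ≤ μ(G)`. Proof: `ℓ(Xr) ≤ ℓ(ker π) + ℓ(Yr) = ℓ(τ(P/M)) ≤ ℓ(P/M) ≤
ℓ(Λ/(s·2^e·G)) = e + μ(G)` (§1 and w2 GEN 4's semilinear range lemma), then cancel `e` against the archimedean clause. At `e = 0`,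
`Xr = X` this is the strict door `mu_le_mu_of_unitMultiple_of_exact_semilinear_of_finite_fineSelmer_pTorsion`.
[cite: Kato2004Asterisque, §17.13 (pp. 279–280) (shape of the sequence)] [cite: GreenbergLNM1716, §4 Lemma 4.6 (PDF pp. 106–107)]
[cite: Washington1997, §13.2] -/
theorem mu_le_mu_of_relaxedColemanSemilinear_of_arch {G : IwasawaAlgebra 2} (hG : G ≠ 0)
    (θ : IwasawaAlgebra 2 ≃+* IwasawaAlgebra 2)
    (P : Submodule (IwasawaAlgebra 2) (IwasawaAlgebra 2)) (M : Submodule (IwasawaAlgebra 2) P)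
    (τ : P →ₛₗ[(θ : IwasawaAlgebra 2 →+* IwasawaAlgebra 2)] Xr) (π : Xr →ₗ[IwasawaAlgebra 2] Yr.X)
    (hτM : ∀ m ∈ M, τ m = 0) (hπ : Function.Exact τ π) {e : ℕ}
    (himg : ∃ s : IwasawaAlgebra 2, s ∉ IwasawaAlgebra.augIdealP 2 ∧
      s * (PowerSeries.C (((2 : ℕ) : ℤ_[2]) ^ e) * G) ∈ Submodule.map P.subtype M)
    (harch : Module.lengthAt (IwasawaAlgebra 2) D.X
        ⟨IwasawaAlgebra.augIdealP 2, IwasawaAlgebra.isPrime_augIdealP_holds 2⟩ + e ≤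
      Module.lengthAt (IwasawaAlgebra 2) Xr ⟨IwasawaAlgebra.augIdealP 2, IwasawaAlgebra.isPrime_augIdealP_holds 2⟩)
    (hY0 : Module.lengthAt (IwasawaAlgebra 2) Yr.X
      ⟨IwasawaAlgebra.augIdealP 2, IwasawaAlgebra.isPrime_augIdealP_holds 2⟩ = 0) : D.mu ≤ mu G := by
  let 𝔭 : PrimeSpectrum (IwasawaAlgebra 2) :=
    ⟨IwasawaAlgebra.augIdealP 2, IwasawaAlgebra.isPrime_augIdealP_holds 2⟩
  obtain ⟨s, hs, hsGM⟩ := himg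
  have hs0 : s ≠ 0 := by rintro rfl; exact hs (Submodule.zero_mem _)
  -- `ℓ₍₂₎(Λ/(s·2^e·G)) = e + μ(G)`
  have hsG : Module.lengthAt (IwasawaAlgebra 2)
      (IwasawaAlgebra 2 ⧸ Ideal.span {s * (PowerSeries.C (((2 : ℕ) : ℤ_[2]) ^ e) * G)}) 𝔭 = e + mu G := by
    rw [Module.lengthAt_quotient_span_singleton_mul _ hs0 𝔭,
      Module.lengthAt_quotient_eq_zero_of_not_le (I := Ideal.span {s})
        (by rwa [Ideal.span_singleton_le_iff_mem]), zero_add,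
      lengthAt_augIdealP_quotient_span_C_pow_mul hG e 𝔭 rfl]
  -- `ℓ₍₂₎(Xr) ≤ e + μ(G)`
  have hXr : Module.lengthAt (IwasawaAlgebra 2) Xr 𝔭 ≤ e + mu G := by
    set M' : Ideal (IwasawaAlgebra 2) := Submodule.map P.subtype M with hM'
    have hspan : Ideal.span {s * (PowerSeries.C (((2 : ℕ) : ℤ_[2]) ^ e) * G)} ≤ M' := by
      rw [Ideal.span_singleton_le_iff_mem]; exact hsGM
    -- `Λ/(s·2^e·G) ↠ Λ/M'`
    have hΛM : Module.lengthAt (IwasawaAlgebra 2) (IwasawaAlgebra 2 ⧸ M') 𝔭 ≤ e + mu G := by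
      rw [← hsG]
      exact Module.lengthAt_le_of_surjective (Submodule.factor hspan) (Submodule.factor_surjective hspan) 𝔭
    -- `P/M ↪ Λ/M'`
    have hPM : Module.lengthAt (IwasawaAlgebra 2) (P ⧸ M) 𝔭 ≤ e + mu G := by
      refine le_trans ?_ hΛM
      refine Module.lengthAt_le_of_injective (Submodule.mapQ M M' P.subtype fun y hy => ⟨y, hy, rfl⟩) ?_ 𝔭
      rw [← LinearMap.ker_eq_bot, Submodule.ker_mapQ, hM',
        Submodule.comap_map_eq_of_injective P.injective_subtype, Submodule.mkQ_map_self]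
    -- `ker π = τ(P/M)`, a `θ`-semilinear image
    have hle : M ≤ LinearMap.ker τ := fun m hm => hτM m hm
    let f' : (P ⧸ M) →ₛₗ[(θ : IwasawaAlgebra 2 →+* IwasawaAlgebra 2)] Xr := M.liftQ τ hle
    have hK : ∀ x, x ∈ LinearMap.ker π ↔ x ∈ Set.range f' := by
      intro x
      rw [LinearMap.mem_ker]
      constructor
      · intro hx
        obtain ⟨u, rfl⟩ := (hπ x).1 hx
        exact ⟨Submodule.Quotient.mk u, Submodule.liftQ_apply _ _ u⟩
      · rintro ⟨q, rfl⟩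
        obtain ⟨u, rfl⟩ := Submodule.mkQ_surjective M q
        exact (hπ _).2 ⟨u, (Submodule.liftQ_apply _ _ u).symm⟩
    have hker : Module.lengthAt (IwasawaAlgebra 2) (LinearMap.ker π) 𝔭 ≤ e + mu G :=
      (lengthAt_le_of_range_semilinear θ f' (LinearMap.ker π) hK 𝔭 rfl).trans hPM
    have hY0' : Module.lengthAt (IwasawaAlgebra 2) Yr.X 𝔭 = 0 := hY0
    calc Module.lengthAt (IwasawaAlgebra 2) Xr 𝔭
        ≤ Module.lengthAt (IwasawaAlgebra 2) (LinearMap.ker π) 𝔭 + Module.lengthAt (IwasawaAlgebra 2) Yr.X 𝔭 :=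
          Module.lengthAt_le_add_of_exact (LinearMap.ker π).subtype π (LinearMap.exact_subtype_ker_map π) 𝔭
      _ ≤ e + mu G := by rw [hY0', add_zero]; exact hker
  -- cancel the archimedean `e`
  have hX : Module.lengthAt (IwasawaAlgebra 2) D.X 𝔭 ≤ mu G := by
    have h : (e : ℕ∞) + Module.lengthAt (IwasawaAlgebra 2) D.X 𝔭 ≤ (e : ℕ∞) + mu G := by
      rw [add_comm]; exact harch.trans hXr
    exact (WithTop.add_le_add_iff_left (WithTop.coe_ne_top (a := e))).mp h
  change muInvariant 2 D.X ≤ mu G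
  rw [muInvariant_eq_toNat_lengthAt 2 D.X 𝔭 rfl]
  exact_mod_cast (ENat.coe_toNat_le_self _).trans hX

omit [W.IsElliptic] [W.IsGloballyMinimal] in
/-- **THE RELAXED `μ = 0` DOOR (KERNEL; no half class)** — the `G₁ ∉ (2)` case of the slack door: relaxed data
`(θ, P, M, τ : P →ₛₗ[θ] Xr, π : Xr ↠ X₀^{rel})`, image clause `s·(2^e·G₁) ∈ M` with `s, G₁ ∉ (2)`, archimedean clause
`ℓ₍₂₎(X) + e ≤ ℓ₍₂₎(Xr)`, relaxed (A₂) `ℓ₍₂₎(X₀^{rel}) = 0` ⇒ `μ(X) = 0`. [cite: Kato2004Asterisque, §17.13 (pp. 279–280) (shape)]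
[cite: GreenbergLNM1716, §1 p. 60 and §4 Lemma 4.6] -/
theorem mu_eq_zero_of_relaxedColemanSemilinear_of_arch {G₁ : IwasawaAlgebra 2}
    (hμL : G₁ ∉ IwasawaAlgebra.augIdealP 2) (θ : IwasawaAlgebra 2 ≃+* IwasawaAlgebra 2)
    (P : Submodule (IwasawaAlgebra 2) (IwasawaAlgebra 2)) (M : Submodule (IwasawaAlgebra 2) P)
    (τ : P →ₛₗ[(θ : IwasawaAlgebra 2 →+* IwasawaAlgebra 2)] Xr) (π : Xr →ₗ[IwasawaAlgebra 2] Yr.X)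
    (hτM : ∀ m ∈ M, τ m = 0) (hπ : Function.Exact τ π) {e : ℕ}
    (himg : ∃ s : IwasawaAlgebra 2, s ∉ IwasawaAlgebra.augIdealP 2 ∧
      s * (PowerSeries.C (((2 : ℕ) : ℤ_[2]) ^ e) * G₁) ∈ Submodule.map P.subtype M)
    (harch : Module.lengthAt (IwasawaAlgebra 2) D.X
        ⟨IwasawaAlgebra.augIdealP 2, IwasawaAlgebra.isPrime_augIdealP_holds 2⟩ + e ≤
      Module.lengthAt (IwasawaAlgebra 2) Xr ⟨IwasawaAlgebra.augIdealP 2, IwasawaAlgebra.isPrime_augIdealP_holds 2⟩)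
    (hY0 : Module.lengthAt (IwasawaAlgebra 2) Yr.X
      ⟨IwasawaAlgebra.augIdealP 2, IwasawaAlgebra.isPrime_augIdealP_holds 2⟩ = 0) : D.mu = 0 := by
  have hG0 : G₁ ≠ 0 := by rintro rfl; exact hμL (Submodule.zero_mem _)
  have hred : red G₁ ≠ 0 := by
    intro h
    rw [red_eq_zero_iff] at h
    exact hμL (by rw [IwasawaAlgebra.augIdealP, Ideal.mem_span_singleton]; exact h)
  have hmu : mu G₁ = 0 := (mu_eq_and_pfree_eq (a := 0) hred (by simp)).1
  have h := mu_le_mu_of_relaxedColemanSemilinear_of_arch (D := D) hG0 θ P M τ π hτM hπ himg harch hY0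
  omega

/-- **Relaxed (A₂) in its finiteness form feeds the door**: «`Sel₀^{rel ∞}(E/ℚ_∞, E[2^∞])[2]` finite» ⇒ `ℓ₍₂₎(X₀^{rel ∞}) = 0`
for every relaxed dual fine datum w.r.t. a topological generator (cell bsd-f1-sign2, `…FineRoadLimRelUpstairs`, restated in this
line's namespace). [cite: CoatesSujatha2005, statement (A) (§3)] [cite: GreenbergLNM1716, §1 p. 60] -/
theorem lengthAt_fineRelaxed_eq_zero_of_finite_pTorsion {W : WeierstrassCurve ℚ} {κ : ZpExtension ℚ 2}
    {γ : absoluteGaloisGroup ℚ} (hγ : κ.IsTopGenerator γ) (Yr : W.FineSelmerDualDataRelaxedInf κ γ)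
    (hfin : Set.Finite {s : W.fineSelmerInftyRelaxedInf κ | 2 • s = 0}) :
    Module.lengthAt (IwasawaAlgebra 2) Yr.X ⟨IwasawaAlgebra.augIdealP 2, IwasawaAlgebra.isPrime_augIdealP_holds 2⟩ = 0 :=
  LimRelUpstairs.lengthAt_relaxed_eq_zero_of_finite_pTorsion W κ hγ Yr hfin

omit [W.IsElliptic] [W.IsGloballyMinimal] in
/-- **The relaxed `μ = 0` door with relaxed (A₂) as «`Sel₀^{rel ∞}[2]` finite»** (topological generator `γ`).
[cite: CoatesSujatha2005, statement (A) (§3)] [cite: Kato2004Asterisque, §17.13 (pp. 279–280) (shape)] -/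
theorem mu_eq_zero_of_relaxedColemanSemilinear_of_arch_of_finite_fineRelaxed_pTorsion
    (hγ : κ.IsTopGenerator γ) {G₁ : IwasawaAlgebra 2}
    (hμL : G₁ ∉ IwasawaAlgebra.augIdealP 2) (θ : IwasawaAlgebra 2 ≃+* IwasawaAlgebra 2)
    (P : Submodule (IwasawaAlgebra 2) (IwasawaAlgebra 2)) (M : Submodule (IwasawaAlgebra 2) P)
    (τ : P →ₛₗ[(θ : IwasawaAlgebra 2 →+* IwasawaAlgebra 2)] Xr) (π : Xr →ₗ[IwasawaAlgebra 2] Yr.X)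
    (hτM : ∀ m ∈ M, τ m = 0) (hπ : Function.Exact τ π) {e : ℕ}
    (himg : ∃ s : IwasawaAlgebra 2, s ∉ IwasawaAlgebra.augIdealP 2 ∧
      s * (PowerSeries.C (((2 : ℕ) : ℤ_[2]) ^ e) * G₁) ∈ Submodule.map P.subtype M)
    (harch : Module.lengthAt (IwasawaAlgebra 2) D.X
        ⟨IwasawaAlgebra.augIdealP 2, IwasawaAlgebra.isPrime_augIdealP_holds 2⟩ + e ≤
      Module.lengthAt (IwasawaAlgebra 2) Xr ⟨IwasawaAlgebra.augIdealP 2, IwasawaAlgebra.isPrime_augIdealP_holds 2⟩)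
    (hfin : Set.Finite {s : W.fineSelmerInftyRelaxedInf κ | 2 • s = 0}) : D.mu = 0 :=
  mu_eq_zero_of_relaxedColemanSemilinear_of_arch hμL θ P M τ π hτM hπ himg harch
    (lengthAt_fineRelaxed_eq_zero_of_finite_pTorsion hγ Yr hfin)

omit [W.IsElliptic] [W.IsGloballyMinimal] in
/-- **The archimedean clause at `e = 1` from the EXTENSION STRUCTURE** ([ASP] Thm 6.9 (i) as data): a surjection
`q : Xr ↠ X` (dual of `Sel ≤ Sel^{rel}`) and an injection `Λ/(2) ↪ ker q` (the archimedean `H¹(ℝ, T₂E)⟦Γ⟧ = Λ/2` inside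
`(Sel^{rel}/Sel)^∨`) give `ℓ₍₂₎(X) + 1 ≤ ℓ₍₂₎(Xr)` (§1). [cite: GreenbergLNM1716, §4 Lemma 4.6 (PDF pp. 106–107)]
[cite: Washington1997, §13.2] -/
theorem lengthAt_add_one_le_of_archExtension (q : Xr →ₗ[IwasawaAlgebra 2] D.X) (hq : Function.Surjective q)
    (j : (IwasawaAlgebra 2 ⧸ IwasawaAlgebra.augIdealP 2) →ₗ[IwasawaAlgebra 2] LinearMap.ker q) (hj : Function.Injective j) :
    Module.lengthAt (IwasawaAlgebra 2) D.X ⟨IwasawaAlgebra.augIdealP 2, IwasawaAlgebra.isPrime_augIdealP_holds 2⟩ + ((1 : ℕ) : ℕ∞) ≤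
      Module.lengthAt (IwasawaAlgebra 2) Xr ⟨IwasawaAlgebra.augIdealP 2, IwasawaAlgebra.isPrime_augIdealP_holds 2⟩ :=
  lengthAt_add_le_of_surjective_of_le_lengthAt_ker q hq _
    (by rw [Nat.cast_one]; exact one_le_lengthAt_of_injective_of_quotient_augIdealP j hj _ rfl)

omit [W.IsElliptic] [W.IsGloballyMinimal] in
/-- **THE RELAXED `μ = 0` DOOR, EXTENSION FORM (KERNEL; no half class)** — the shape the displayed binders feed: relaxed data
`(θ, P, M, τ : P →ₛₗ[θ] Xr, π)` exact after `τ`, GENUINE image clause `s·(2·G₁) ∈ M` (`s, G₁ ∉ (2)`; booked at `c_∞·L₂`, `c_∞ = 2`),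
the archimedean EXTENSION `Λ/2 ↪ ker(Xr ↠ X)` and relaxed (A₂) «`Sel₀^{rel ∞}(E/ℚ_∞)[2]` finite» ⇒ `μ(X(E/ℚ_∞)) = 0`.
[cite: Kato2004Asterisque, §17.13 (pp. 279–280) (shape)] [cite: GreenbergLNM1716, §4 Lemma 4.6 (PDF pp. 106–107)]
[cite: CoatesSujatha2005, statement (A) (§3)] -/
theorem mu_eq_zero_of_relaxedColemanSemilinear_of_archExtension_of_finite_fineRelaxed_pTorsion
    (hγ : κ.IsTopGenerator γ) {G₁ : IwasawaAlgebra 2}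
    (hμL : G₁ ∉ IwasawaAlgebra.augIdealP 2) (θ : IwasawaAlgebra 2 ≃+* IwasawaAlgebra 2)
    (P : Submodule (IwasawaAlgebra 2) (IwasawaAlgebra 2)) (M : Submodule (IwasawaAlgebra 2) P)
    (τ : P →ₛₗ[(θ : IwasawaAlgebra 2 →+* IwasawaAlgebra 2)] Xr) (π : Xr →ₗ[IwasawaAlgebra 2] Yr.X)
    (hτM : ∀ m ∈ M, τ m = 0) (hπ : Function.Exact τ π)
    (himg : ∃ s : IwasawaAlgebra 2, s ∉ IwasawaAlgebra.augIdealP 2 ∧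
      s * (PowerSeries.C (((2 : ℕ) : ℤ_[2]) ^ 1) * G₁) ∈ Submodule.map P.subtype M)
    (q : Xr →ₗ[IwasawaAlgebra 2] D.X) (hq : Function.Surjective q)
    (j : (IwasawaAlgebra 2 ⧸ IwasawaAlgebra.augIdealP 2) →ₗ[IwasawaAlgebra 2] LinearMap.ker q) (hj : Function.Injective j)
    (hfin : Set.Finite {s : W.fineSelmerInftyRelaxedInf κ | 2 • s = 0}) : D.mu = 0 :=
  mu_eq_zero_of_relaxedColemanSemilinear_of_arch hμL θ P M τ π hτM hπ himg
    (lengthAt_add_one_le_of_archExtension q hq j hj) (lengthAt_fineRelaxed_eq_zero_of_finite_pTorsion hγ Yr hfin)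

end PerDatum

/-! ## §3 Kato's `μ`-part at ONE `E[2]`-irreducible curve from the relaxed data -/

/-- **`X5.O1.KatoMuPartAtTwo W` at ONE curve with `E[2]` IRREDUCIBLE from the RELAXED data for every newform and all cyclotomic
data of `W`** — for each Selmer dual datum `D` and relaxed fine datum `Yr`: SOME relaxed module `Xr` with the package
`(θ, P, M, τ, π)`, an exponent `e` (= `ord₂ c_∞`), the image clause at `2^e·G₁` for every integral lift `G₁` of `L₂(f, α)` and the
archimedean clause `ℓ₍₂₎(X) + e ≤ ℓ₍₂₎(Xr)` — together with RELAXED (A₂) «`ℓ₍₂₎(Yr.X) = 0` for every cyclotomic `κ`, generator `γ`,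
datum `Yr`». No Néron ratio: analytic `μ₂ = 0` (p642753) gives `G₁ ∉ (2)`, §2 gives `μ = 0`, `2^0 ∣ L₀`. The `∃`-over-Types shape is
a DOOR; the displayed binder pinning `Xr := X^{rel ∞}` is the sequel. [cite: GreenbergLNM1716, §1 p. 60, Conj. 1.11 (shape)]
[cite: Kato2004Asterisque, §17.13 (pp. 279–280)] [cite: MazurTateTeitelbaum1986Invent, §I.12] -/
theorem katoMuPartAtTwo_of_relaxedColeman_irr (W : WeierstrassCurve ℚ) [W.IsElliptic] [W.IsGloballyMinimal]
    (hirr : W.HasIrreducibleModPGaloisRep 2)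
    (hR : ∀ {N : ℕ} [NeZero N] (f : CuspForm (Gamma0 N) 2) (κ : ZpExtension ℚ 2) (γ : absoluteGaloisGroup ℚ),
      κ.IsCyclotomic → κ.IsTopGenerator γ → IsCyclotomicVariable 2 γ → IsNewformOf W f →
      ∀ (D : W.SelmerDualData κ γ) (Yr : W.FineSelmerDualDataRelaxedInf κ γ),
        ∃ (Xr : Type) (_ : AddCommGroup Xr) (_ : Module (IwasawaAlgebra 2) Xr)
          (θ : IwasawaAlgebra 2 ≃+* IwasawaAlgebra 2) (P : Submodule (IwasawaAlgebra 2) (IwasawaAlgebra 2))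
          (M : Submodule (IwasawaAlgebra 2) P)
          (τ : P →ₛₗ[(θ : IwasawaAlgebra 2 →+* IwasawaAlgebra 2)] Xr) (π : Xr →ₗ[IwasawaAlgebra 2] Yr.X) (e : ℕ),
          (∀ m ∈ M, τ m = 0) ∧ Function.Surjective π ∧ Function.Exact τ π ∧
          Module.lengthAt (IwasawaAlgebra 2) D.X
              ⟨IwasawaAlgebra.augIdealP 2, IwasawaAlgebra.isPrime_augIdealP_holds 2⟩ + e ≤
            Module.lengthAt (IwasawaAlgebra 2) Xr ⟨IwasawaAlgebra.augIdealP 2, IwasawaAlgebra.isPrime_augIdealP_holds 2⟩ ∧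
          ∀ G₁ : IwasawaAlgebra 2, iwasawaToPowerSeries 2 G₁ = padicLFunction f (unitRoot W 2 : ℚ_[2]) →
            ∃ s : IwasawaAlgebra 2, s ∉ IwasawaAlgebra.augIdealP 2 ∧
              s * (PowerSeries.C (((2 : ℕ) : ℤ_[2]) ^ e) * G₁) ∈ Submodule.map P.subtype M)
    (hAr : ∀ (κ : ZpExtension ℚ 2) (γ : absoluteGaloisGroup ℚ), κ.IsCyclotomic → κ.IsTopGenerator γ →
      ∀ Yr : W.FineSelmerDualDataRelaxedInf κ γ,
        Module.lengthAt (IwasawaAlgebra 2) Yr.X ⟨IwasawaAlgebra.augIdealP 2, IwasawaAlgebra.isPrime_augIdealP_holds 2⟩ = 0) :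
    O1.KatoMuPartAtTwo W := by
  intro κ γ hκ hγ hγ' hord _ f hf ϖ _ D L₀ _
  obtain ⟨Yr⟩ := W.nonempty_fineSelmerDualDataRelaxedInf κ hγ
  obtain ⟨Xr, _, _, θ, P, M, τ, π, e, hτM, -, hπ, harch, himg⟩ := hR f κ γ hκ hγ hγ' hf D Yr
  -- `L₂(f, α) ∈ ι(Λ)` (INT2-AUTO) and analytic `μ₂ = 0` for `E[2]` irreducible: `G₁ ∉ (2)`
  obtain ⟨G₁, hG₁⟩ := exists_iwasawaToPowerSeries_eq_padicLFunction_two_auto (W := W) (f := f) hord hf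
  obtain ⟨k, hk⟩ := AnalyticMuTwo.exists_norm_padicLCoeff_two_eq_one W hord hirr hf
  have hμL : G₁ ∉ IwasawaAlgebra.augIdealP 2 :=
    not_mem_augIdealP_of_norm_coeff_eq_one hG₁ ⟨k, by rw [coeff_padicLFunction]; exact hk⟩
  rw [mu_eq_zero_of_relaxedColemanSemilinear_of_arch (D := D) hμL θ P M τ π hτM hπ (himg G₁ hG₁) harch
    (hAr κ γ hκ hγ Yr), pow_zero, map_one]
  exact one_dvd _

end Summit.BirchSwinnertonDyer.BirchSwinnertonDyer.Theorems.SteinbergFibreAtTwo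

end
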